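import Literature.MathematicalPhysics.KineticTheory.HardSphereEulerSobolevTools
import HarnessLib

/-!
# RelayRaceLocality · ConeLocalisation — bubble stub, helper (PC0, part T3): the derivative-only
# Sobolev read-out on `𝕋³`

Helper file for the lead-held stub `stub_bubble : BubbleAtScale` of the line `Sketch`
(zoomed-bubble-transplant) of the crux item `stmt-AtomisticToContinuum-12504` (`ConeLocalisation`,
route RelayRaceLocality of `AtomisticToContinuum/HydrodynamicLimit`), lead
prover-line-stmt-AtomisticToContinuum-12504-0 (2026-08-17); sibling of `…BubbleReadouts.lean`.

* `partialDeriv_sq_le_derivEnergies` — ONE constant `KS > 0` with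
  `(∂ₗ f x)² ≤ KS · (Σ ∫ (∂f)² + Σ ∫ (∂²f)² + Σ ∫ (∂³f)²)` for every smooth real field `f` on `𝕋³`,
  and the same with norms for `V3`-valued fields: the sup of a FIRST derivative is controlled by
  the derivative energies of levels `1, 2, 3` only (no zeroth-order term) — the unweighted case
  `ω ≡ 1`, `m = 1` of clauses (M2) of `HsEulerCalc.sup_le_of_weighted_energies` (`H²(𝕋³) ⊂ L^∞`
  applied to `∂ₗ f`). This is the read-out that turns the homogeneous level-3 energy bound of the
  zoomed bubble into the `r`-free `C¹` guard of `BubbleAtScale`.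

Reference: R. A. Adams, *Sobolev Spaces* (1975), Thm 5.4 Part I Case C (`H² ⊂ C⁰` in dimension 3).
-/

noncomputable section

namespace Summit.AtomisticToContinuum.HydrodynamicLimit.Theorems.ConeLocalisation.Bubble

open MeasureTheory
open Literature.MathematicalPhysics.KineticTheory Literature.Analysis.FunctionSpaces

/-- **Derivative-only Sobolev read-out on `𝕋³`** (`H² ⊂ L^∞` applied to first derivatives): ONE
constant `KS > 0` such that for every smooth `f : 𝕋³ → ℝ`, direction `l` and point `x`,
`(∂ₗ f x)² ≤ KS · (Σ_{l'} ∫ (∂_{l'} f)² + Σᵢ Σ_{l'} ∫ (∂ᵢ ∂_{l'} f)²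
  + Σⱼ Σᵢ Σ_{l'} ∫ (∂ⱼ ∂ᵢ ∂_{l'} f)²)` (index order of the tree), and the same with norms for smooth `f : 𝕋³ → V3` — no zeroth-order
term. The unweighted case
`ω ≡ 1`, `m = 1` of clauses (M2) of `HsEulerCalc.sup_le_of_weighted_energies`. [folklore] -/
theorem partialDeriv_sq_le_derivEnergies :
    ∃ KS : ℝ, 0 < KS ∧
      (∀ f : T3 → ℝ, Torus.IsSmooth f → ∀ (l : Fin 3) (x : T3),
        Torus.partialDeriv l f x ^ 2 ≤ KS *
          ((∑ l', ∫ y, Torus.partialDeriv l' f y ^ 2) +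
            (∑ i, ∑ l', ∫ y, Torus.partialDeriv i (Torus.partialDeriv l' f) y ^ 2) +
              ∑ j, ∑ i, ∑ l', ∫ y,
                Torus.partialDeriv j (Torus.partialDeriv i (Torus.partialDeriv l' f)) y ^ 2)) ∧
      (∀ f : T3 → V3, Torus.IsSmooth f → ∀ (l : Fin 3) (x : T3),
        ‖Torus.partialDeriv l f x‖ ^ 2 ≤ KS *
          ((∑ l', ∫ y, ‖Torus.partialDeriv l' f y‖ ^ 2) +
            (∑ i, ∑ l', ∫ y, ‖Torus.partialDeriv i (Torus.partialDeriv l' f) y‖ ^ 2) +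
              ∑ j, ∑ i, ∑ l', ∫ y,
                ‖Torus.partialDeriv j
                  (Torus.partialDeriv i (Torus.partialDeriv l' f)) y‖ ^ 2)) := by
  obtain ⟨K, hK, -, -, hℝ, hV⟩ := HsEulerCalc.sup_le_of_weighted_energies
  refine ⟨K, hK, fun f hf l x => ?_, fun f hf l x => ?_⟩
  · have h := @hℝ (fun _ => (1 : ℝ)) 1 continuous_const one_pos (fun _ => le_rfl) f hf l x
    simpa only [one_mul, inv_one, mul_one] using h
  · have h := @hV (fun _ => (1 : ℝ)) 1 continuous_const one_pos (fun _ => le_rfl) f hf l x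
    simpa only [one_mul, inv_one, mul_one] using h

end Summit.AtomisticToContinuum.HydrodynamicLimit.Theorems.ConeLocalisation.Bubble

end
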